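import Mathlib
import HarnessLib
import Summits.Ventures.LatticeQCDFlow.Scoring.IndepMHRegenerativeSigma
import Summits.Ventures.LatticeQCDFlow.Scoring.RegenerativeMedianOfGroupsSigma
import Summits.Ventures.LatticeQCDFlow.Scoring.IndepMHRetrospectiveCoins

/-!
# An IMPLEMENTABLE certified protocol for independence Metropolis: the coin-augmented sampler
# (retrospective regeneration coins) carries the CLT-scale regenerative error bar, the exponential
# median-of-groups confidence and the consistent variance estimator — from any start

HONEST FRAMING: exact (Metropolis-corrected) sampling algorithms for lattice gauge theory;
figures of merit are autocorrelation/cost numbers at stated couplings and volumes; no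
continuum-physics claim.

Venture `LatticeQCDFlow` (cell pub-lqcd), topic `Scoring`; FANOUT row 8 (`s0-cpn-nemc`, GEN-17).
NEW WORK of the cell, not a published result; no definition is introduced.  Composition of
`Scoring/IndepMHRetrospectiveCoins.lean` (the Mykland–Tierney–Yu coin-augmented Metropolis step IS a
split kernel of `(indepMH q (1/ρ), π, e^{−M})`) with the certificates of
`Scoring/IndepMHRegenerativeSigma.lean` and `Scoring/RegenerativeMedianOfGroupsSigma.lean`: there is
ONE Markov kernel `κ̂` on `Ω × Bool` — explicitly the implementable step "propose `y ∼ q`, accept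
with probability `min(1, ρ x/ρ y)`, on acceptance flip heads with probability
`e^{−M} max(1/ρ x, 1/ρ y)`, on rejection tails" — such that, for every bounded measurable `f`, every
initial law and every `R`, `m`, `K`, `s`, `a`: the tour estimator built from the heads of `κ̂` obeys
`P(s ≤ |Â_R − π(f)|) ≤ 4(e^{−M} σ²_f/s² + 1 − e^{−M})/R`, the median of `K` group estimates of `m`
tours each is off by `≥ s` with probability `≤ e^{−K/8}` once `4(e^{−M} σ²_f/s² + 1 − e^{−M})/m ≤ 1/4`,
and the plug-in variance estimator is consistent at the stated rate — a complete regenerative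
error-bar protocol whose every step is computable from `ρ` up to scale and the constant `M`.
Printed counterpart NAMED ONLY: Mykland–Tierney–Yu 1995 §4.1; Hobert–Jones–Presnell–Rosenthal 2002
— nothing is cited as a fact.

## Content

* **`indepMH_regenerative_protocol`** — the existence-and-certificates statement above.

NOT CLAIMED: any `M` for a concrete proposal; optimal constants; a CLT.
-/

noncomputable section

namespace Summit.Ventures.LatticeQCDFlow.Scoring

open MeasureTheory ProbabilityTheory Filter Finset Summit.Ventures.LatticeQCDFlow.Exactness
open Literature.Probability.MarkovChains
open scoped ENNReal

variable {Ω : Type*} [MeasurableSpace Ω]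

/-- **THE IMPLEMENTABLE REGENERATIVE PROTOCOL FOR INDEPENDENCE METROPOLIS.**  `q = ρ·π` with `ρ > 0`
measurable, `ρ x ≤ e^{M} ρ y`, `M > 0`.  There is a Markov kernel `κ̂` on `Ω × Bool`, equal at every
`(x, b)` to the coin-augmented Metropolis step from `x`, such that for all bounded measurable `f`
(`|f| ≤ C`), all initial laws, `R ≥ 1`, `s > 0`: (i) the CLT-scale error bar of the tour estimator,
(ii) for `m ≥ 1` with `4(e^{−M} σ²_f/s² + (1 − e^{−M}))/m ≤ 1/4` and every `K` the median-of-groups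
bound `e^{−K/8}`, (iii) for `a > 0` the plug-in variance estimator's consistency bound. -/
theorem indepMH_regenerative_protocol {π q : Measure Ω} [IsProbabilityMeasure π]
    [IsProbabilityMeasure q] {ρ : Ω → ℝ} (hρm : Measurable ρ) (hρ0 : ∀ x, 0 < ρ x)
    (hq : q = π.withDensity fun x => ENNReal.ofReal (ρ x)) {M : ℝ} (hM0 : 0 < M)
    (hM : ∀ x y, ρ x ≤ Real.exp M * ρ y) :
    haveI : Fact (Measurable fun z => (ρ z)⁻¹) := ⟨hρm.inv⟩
    ∃ κs : Kernel (Ω × Bool) (Ω × Bool), ∃ _ : IsMarkovKernel κs,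
      (∀ p, κs p = (q.withDensity (fun y => imhAcceptE (fun z => (ρ z)⁻¹) p.1 y
          * ENNReal.ofReal (Real.exp (-M) * max (ρ p.1)⁻¹ (ρ y)⁻¹))).map (fun y : Ω => (y, true))
        + ((q.withDensity (fun y => imhAcceptE (fun z => (ρ z)⁻¹) p.1 y
            * (1 - ENNReal.ofReal (Real.exp (-M) * max (ρ p.1)⁻¹ (ρ y)⁻¹))))
          + (1 - imhAcceptMass q (fun z => (ρ z)⁻¹) p.1) • Measure.dirac p.1).map
            (fun y : Ω => (y, false))) ∧
      ∀ (μs : Measure (Ω × Bool)) [IsProbabilityMeasure μs] (f : Ω → ℝ), Measurable f →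
        ∀ C : ℝ, (∀ x, |f x| ≤ C) → ∀ R : ℕ, 0 < R → ∀ s : ℝ, 0 < s →
        -- (i) the tour estimator at the CLT scale
        (Kernel.trajMeasure (X := fun _ : ℕ => Ω × Bool) μs
            (fun n : ℕ => κs.comap (fun h : (i : ↥(Finset.Iic n)) → Ω × Bool =>
              h ⟨n, Finset.mem_Iic.2 le_rfl⟩) (measurable_pi_apply _))).real
          {x | s ≤ |(∑ i ∈ Finset.range R, ∑' u, (if (∑ s ∈ Finset.range u,
                (if (x (s + 1)).2 then (1 : ℕ) else 0)) = i + 1 then (1 : ℝ) else 0) * f (x u).1)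
              / (∑ i ∈ Finset.range R, ∑' u, (if (∑ s ∈ Finset.range u,
                (if (x (s + 1)).2 then (1 : ℕ) else 0)) = i + 1 then (1 : ℝ) else 0))
              - ∫ z, f z ∂π|}
          ≤ 4 * (Real.exp (-M) * ((∫ y, (f y - ∫ z, f z ∂π) ^ 2 ∂π)
              + 2 * ∑' k, ∫ y, (f y - ∫ z, f z ∂π)
                * (kop (indepMH q fun x => (ρ x)⁻¹))^[k + 1] (fun y => f y - ∫ z, f z ∂π) y ∂π)
              / s ^ 2 + (1 - Real.exp (-M))) / R
        -- (ii) the median of tour groups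
        ∧ (∀ m : ℕ, 0 < m →
            4 * (Real.exp (-M) * ((∫ y, (f y - ∫ z, f z ∂π) ^ 2 ∂π)
              + 2 * ∑' k, ∫ y, (f y - ∫ z, f z ∂π)
                * (kop (indepMH q fun x => (ρ x)⁻¹))^[k + 1] (fun y => f y - ∫ z, f z ∂π) y ∂π)
              / s ^ 2 + (1 - Real.exp (-M))) / m ≤ 1 / 4 →
            ∀ K : ℕ, (Kernel.trajMeasure (X := fun _ : ℕ => Ω × Bool) μs
              (fun n : ℕ => κs.comap (fun h : (i : ↥(Finset.Iic n)) → Ω × Bool =>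
                h ⟨n, Finset.mem_Iic.2 le_rfl⟩) (measurable_pi_apply _))).real
            {x | (K : ℝ) / 2 ≤ ∑ k ∈ Finset.range K,
              (if s ≤ |(∑ i ∈ Finset.range m, ∑' u, (if (∑ s ∈ Finset.range u,
                    (if (x (s + 1)).2 then (1 : ℕ) else 0)) = k * (m + 1) + i + 1 then (1 : ℝ) else 0)
                    * f (x u).1)
                  / (∑ i ∈ Finset.range m, ∑' u, (if (∑ s ∈ Finset.range u,
                    (if (x (s + 1)).2 then (1 : ℕ) else 0)) = k * (m + 1) + i + 1 then (1 : ℝ) else 0))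
                  - ∫ z, f z ∂π| then (1 : ℝ) else 0)}
            ≤ Real.exp (-((K : ℝ) / 8)))
        -- (iii) the plug-in variance estimator
        ∧ (∀ a : ℝ, 0 < a → (Kernel.trajMeasure (X := fun _ : ℕ => Ω × Bool) μs
              (fun n : ℕ => κs.comap (fun h : (i : ↥(Finset.Iic n)) → Ω × Bool =>
                h ⟨n, Finset.mem_Iic.2 le_rfl⟩) (measurable_pi_apply _))).real
            {x | a + 3 * (4 * C * s + s ^ 2) / Real.exp (-M) ^ 2
              ≤ |(∑ i ∈ Finset.range R, ((∑' u, (if (∑ s ∈ Finset.range u,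
                    (if (x (s + 1)).2 then (1 : ℕ) else 0)) = i + 1 then (1 : ℝ) else 0) * f (x u).1)
                  - ((∑ i ∈ Finset.range R, ∑' u, (if (∑ s ∈ Finset.range u,
                      (if (x (s + 1)).2 then (1 : ℕ) else 0)) = i + 1 then (1 : ℝ) else 0) * f (x u).1)
                    / (∑ i ∈ Finset.range R, ∑' u, (if (∑ s ∈ Finset.range u,
                      (if (x (s + 1)).2 then (1 : ℕ) else 0)) = i + 1 then (1 : ℝ) else 0)))
                  * (∑' u, (if (∑ s ∈ Finset.range u, (if (x (s + 1)).2 then (1 : ℕ) else 0)) = i + 1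
                    then (1 : ℝ) else 0))) ^ 2) / R
                - ∫ y, (∑' u, (if (∑ s ∈ Finset.range u, (if (y (s + 1)).2 then (1 : ℕ) else 0)) = 0
                  then (1 : ℝ) else 0) * (f (y u).1 - ∫ z, f z ∂π)) ^ 2
                  ∂(Kernel.trajMeasure (X := fun _ : ℕ => Ω × Bool) (π.map (fun y : Ω => (y, true)))
                    (fun n : ℕ => κs.comap (fun h : (i : ↥(Finset.Iic n)) → Ω × Bool =>
                      h ⟨n, Finset.mem_Iic.2 le_rfl⟩) (measurable_pi_apply _)))|}
            ≤ ((2 * C) ^ 4 * 24 / (Real.exp (-M) ^ 4 * a ^ 2) + 24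
                + 4 * ((2 - Real.exp (-M)) * (2 * C) ^ 2 / s ^ 2 + (1 - Real.exp (-M)))) / R) := by
  haveI : Fact (Measurable fun z => (ρ z)⁻¹) := ⟨hρm.inv⟩
  obtain ⟨κs, hκsM, hretro, hκs⟩ := exists_indepMH_retroKernel hρm hρ0 hq hM0 hM
  refine ⟨κs, hκsM, hretro, fun μs _ f hf C hC R hR s hs => ⟨?_, fun m hm hsmall K => ?_,
    fun a ha => ?_⟩⟩
  · exact indepMH_regenerative_confidence_sigma hρm hρ0 hq hM0 hM κs hκs μs hf hC hR hs
  · exact indepMH_regenerative_medianOfGroups_sigma hρm hρ0 hq hM0 hM κs hκs μs hf hC hm hs hsmall K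
  · exact indepMH_variance_plugIn_confidence hρm hρ0 hq hM0 hM κs hκs μs hf hC hR ha hs

end Summit.Ventures.LatticeQCDFlow.Scoring

end
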